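/-
Copyright (c) 2026 the pub-hodgecm-mathlib formalisation cell (harness21).  Prover seat hodgecm-mathlib-K2E4-p13 (g0),
Track B «K2-LIT» ∕ h413, ENGINE E4 unit U6 `ArchLimitConstant` — the H-STEP DATA `hH` of K2E4-p09's #9 assembly (★ p855083) as a `Nonempty` of its structure `HStepData`.  2026-09-03.
-/
import Summits.HodgeConjecture.HodgeConjecture.Theorems.K2E4ExplicitArchSingularTransferDefs   -- ★ p855024 (K2E4-p09): the structure `HStepData L νw z w₁`
import Summits.HodgeConjecture.HodgeConjecture.Theorems.K2E4ArchHStepLaw                      -- ★ p854988 (this seat): `hStepLaw` (the ∃-form, exact text of `HSTEP.sig.txt`)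
import HarnessLib

/-!
# K2 · E4 · U6: the H-STEP DATA of the #9 assembly — `Nonempty (HStepData L νw z w₁)` at every place, from ★ `hStepLaw`

Cell `pub/hodgecm-mathlib` (D-0151), HCML Track B, crux H413 = `stmt-HodgeConjecture-24833`; socket #9 `sig_K2E4ExplicitArchSingularTransfer`, assembler K2E4-p09: ★ p855083
`Theorems/K2E4ExplicitArchSingularTransferOfPackages.lean` takes `hH : ∀ … νw z w₁, HStepData L νw z w₁` (★ p855024 `…Defs.HStepData`: fields `C`, `C_ne_zero`, `tendsto`).  THIS FILE:
**`hStepData_nonempty`** — `∀ [σ-algs] (νw) [Haar] (z) (w₁), Nonempty (HStepData L νw z w₁)`, by ★ `K2E4ArchHStepLaw.hStepLaw` (= ★ `ArchEndoscopicCentralDescentValue` §5, Harish-Chandra's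
rank-one limit formula descended, at the endoscopic weights `β₂ = (½, −½)`); the assembler's `hH` is `fun νw z w₁ => Classical.choice (hStepData_nonempty L νw z w₁)`.
HONEST LABEL: HC_CM is proved only modulo the 7 printed citations (2 remaining named inputs: hLiu418 = stmt-HodgeConjecture-24832, h413 = stmt-HodgeConjecture-24833) until rung 0 closes;
plumbing, pays no socket by itself.

## References
* [Rogawski1990] J. D. Rogawski, *Automorphic Representations of Unitary Groups in Three Variables*, Ann. of Math. Stud. 123 (1990), §8.2 Prop. 8.2.1 pp. 118–119; §14.5 Lemma 14.5.2 (b)(c) p. 238.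
* [Varadarajan1989] V. S. Varadarajan, *An Introduction to Harmonic Analysis on Semisimple Lie Groups* (1989), §6.4 Thm. 22.
-/

set_option autoImplicit false

noncomputable section

open MeasureTheory NumberField NumberField.InfinitePlace
open scoped MatrixGroups

namespace Summit.HodgeConjecture.HodgeConjecture.Cruxes.H413.K2E4ArchHStepData

open Literature.NumberTheory.Automorphic

/-- **THE H-STEP DATA EXIST at every place** (the assembler's `hH`, structure form): for Haar `νw`, central angles `z` and a place `w₁`, `HStepData L νw z w₁` is inhabited — its `C` is
Harish-Chandra's constant of ★ `exists_tendsto_deriv_two_sin_smul_integral_integral_insert` at `(L, β₂, w₁, νw w₁)`, its `tendsto` the descended rank-one limit formula ★ `hStepLaw`.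
[cite: Rogawski1990, §8.2 Prop. 8.2.1 pp. 118–119; §14.5 Lemma 14.5.2 (b)(c) p. 238] [cite: Varadarajan1989, §6.4 Thm. 22] -/
theorem hStepData_nonempty (L : Type) [Field L] [NumberField L] [IsCMField L]
    [∀ w : {w : InfinitePlace L // IsComplex w}, MeasurableSpace (UnitaryGroup.archLocal L 2 (Matrix.diagonal ![(2 : L)⁻¹, -(2 : L)⁻¹]) w)]
    [∀ w : {w : InfinitePlace L // IsComplex w}, BorelSpace (UnitaryGroup.archLocal L 2 (Matrix.diagonal ![(2 : L)⁻¹, -(2 : L)⁻¹]) w)]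
    (νw : ∀ w : {w : InfinitePlace L // IsComplex w}, Measure (UnitaryGroup.archLocal L 2 (Matrix.diagonal ![(2 : L)⁻¹, -(2 : L)⁻¹]) w)) [∀ w, (νw w).IsHaarMeasure]
    (z : {w : InfinitePlace L // IsComplex w} → Circle) (w₁ : {w : InfinitePlace L // IsComplex w}) :
    Nonempty (K2E4ExplicitArchSingularTransferDefs.HStepData L νw z w₁) := by
  obtain ⟨C, hC, h⟩ := K2E4ArchHStepLaw.hStepLaw L νw z w₁
  exact ⟨⟨C, hC, h⟩⟩

end Summit.HodgeConjecture.HodgeConjecture.Cruxes.H413.K2E4ArchHStepData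

end
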